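import Literature.Computability.AlgebraicComplexity.MatMulBorderRankCertificate
import HarnessLib

/-!
# `bR(⟨2,5,5⟩) ≤ 37` (Smirnov): the explicit approximate algorithm with 37 multiplications, kernel-checked — discharges the named fact `Smirnov2013_borderRank_matMulTensor_255_le` (`≤ 38`)

Topic `Literature/Computability/AlgebraicComplexity`; sibling of `BorderRankMatMul244Smirnov.lean` and
`BorderRankMatMulThreeSmirnov.lean` (same source family, same toolkit) and of
`BorderRankMatMulRectangular.lean`, whose named fact
`Smirnov2013_borderRank_matMulTensor_255_le : algBorderRank (matMulTensor ℂ 2 5 5) ≤ 38` ("[Smirnov]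
also proved `R̲(M_⟨244⟩) ≤ 24`, and `R̲(M_⟨255⟩) ≤ 38`", Conner–Harper–Landsberg 2023, p. 4) is
DISCHARGED there from the (stronger) theorem proved HERE, over every commutative ring:
**`bR(⟨2,5,5⟩) ≤ 37`**, by Smirnov's approximate (APA) bilinear algorithm of length `37` for the
product of a `2 × 5` by a `5 × 5` matrix as distributed in machine-readable form with Benson–Ballard's
*fast-matmul* framework (PPoPP 2015; file `codegen/algorithms/smirnov255-37-262-approx`, "(2, 0, 1)
permutation of algorithms/smirnov552-37-262-approx", i.e. Smirnov's `⟨5,5,2; 37⟩` rotated to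
`⟨2,5,5⟩`; 262 nonzero coefficients), an exact polynomial identity checked by the kernel.  The value
quoted by CHL 2023 from Smirnov's 2013 paper is `38`; the distributed algorithm has length `37`, and
`37 ≤ 38` discharges the fact as printed.

## The data

`37` triples `αᵗ ∈ ℤ[x,x⁻¹]^{2×5}` (on `A`), `βᵗ ∈ ℤ[x,x⁻¹]^{5×5}` (on `B`), `γᵗ ∈ ℤ[x,x⁻¹]^{2×5}`
(on `C = AB`), all entries Laurent monomials in `{0, ±1, ±x, ±x², ±x⁻¹}`, with
`∑ₜ αᵗ_{ij} βᵗ_{j'l} γᵗ_{i'l'} = δ_{ii'} δ_{jj'} δ_{ll'} + O(x)`.  Per product the three columns are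
multiplied by the powers of `x` clearing their poles (and the `C`-column by the power completing the
total to `x³`), giving polynomial vectors `Uₜ, Vₜ, Wₜ` over `ℤ` (degrees `≤ 3`) with
`∑ₜ Uₜ ⊗ Vₜ ⊗ Wₜ = x³ · ⟨2,5,5⟩ + O(x⁴)` — an order-`3` approximate decomposition with `37` triads
(Bläser Def. 6.1).  Confirmed in exact rational and in integer arithmetic before transcription; the
kernel check below IS the proof.

* `Smirnov2013.M255.cU / cV / cW` — the data (product-major, flat row-major slots of `matMulFlat 2 5 5`);
* `Smirnov2013.M255.row_0 … row_9`, `check` — `ApproxCert.check 10 10 25 37 3 1 (matMulFlat 2 5 5) …`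
  by `decide +kernel`, one `C`-coordinate at a time;
* `Smirnov2013_approxRank_three_matMulTensor_255_le` (`R₃(⟨2,5,5⟩) ≤ 37`),
  `Smirnov2013_algBorderRank_matMulTensor_255_le_thirtySeven / _552_le / _525_le` (`bR ≤ 37` in the
  three cyclic formats, every commutative ring).

## References

* [Smirnov2013] A. V. Smirnov, Zh. Vychisl. Mat. Mat. Fiz. 53:12 (2013) 1970–1984; Comput. Math.
  Math. Phys. 53 (2013) 1781–1795, doi:10.1134/S0965542513120129 — approximate algorithms for
  `⟨5,5,2⟩` (results table), quoted as `≤ 38` by CHL 2023 p. 4.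
* [ConnerHarperLandsberg2023] A. Conner, A. Harper, J. M. Landsberg, Forum Math. Pi 11 (2023) e17 —
  §1 p. 4 (the quotation).
* [BensonBallard2015] A. R. Benson, G. Ballard, *A framework for practical parallel fast matrix
  multiplication*, PPoPP 2015, doi:10.1145/2688500.2688513 — software `fast-matmul`, file
  `codegen/algorithms/smirnov255-37-262-approx` (the coefficients used here).
* [Blaser2013] M. Bläser, *Fast Matrix Multiplication*, Theory of Computing Graduate Surveys 5 (2013)
  — Def. 6.1, Thm. 6.3(1).
-/

noncomputable section

open scoped BigOperators

namespace Literature.Computability.AlgebraicComplexity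

namespace Smirnov2013.M255

/-! ## The data: `37` triads of polynomial vectors over `ℤ` (product-major; entry = ascending coefficient list) -/

/-- `Uₜ ∈ ℤ[ε]^{2×5}` (`t = 1, …, 37`): the vectors on the product slot `C = AB` (flat row-major position `l + 5·i` of the entry `(i,l)`), as ascending coefficient lists. [cite: BensonBallard2015, file codegen/algorithms/smirnov255-37-262-approx (Smirnov's approximate ⟨5,5,2; 37⟩)] [cite: Smirnov2013, approximate algorithms for ⟨5,5,2⟩, as quoted in ConnerHarperLandsberg2023 §1 p. 4] -/
def cU : List (List (List ℤ)) :=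
  [[[0, 1], [1], [0, 0, -1], [], [], [1], [], [], [], []],
   [[0, 1], [1], [0, 0, -1], [], [], [], [], [], [], []],
   [[0, 0, -1], [], [0, 0, 0, -1], [0, 0, 0, 1], [], [], [], [], [0, 1], []],
   [[0, -1], [], [], [0, 0, 1], [], [], [], [], [], []],
   [[], [], [], [0, 0, 0, 1], [], [], [0, -1], [], [0, 0, 1], []],
   [[], [0, 0, 1], [], [0, 0, -1], [], [], [], [], [1], []],
   [[0, 1], [], [], [0, 0, -1], [], [1], [], [], [], []],
   [[], [], [], [0, 0, -1], [], [], [1], [], [], []],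
   [[0, 1], [], [], [], [], [], [1], [], [], []],
   [[], [], [], [0, 0, -1], [], [], [], [], [1], []],
   [[], [], [0, 0, 1], [], [], [], [1], [0, 0, -1], [], []],
   [[0, 1], [], [], [], [], [1], [1], [0, 1], [], []],
   [[], [], [], [], [], [-1], [], [], [], []],
   [[1], [], [], [], [], [], [], [], [], []],
   [[], [1], [], [], [], [], [], [], [], []],
   [[], [], [], [], [], [1], [], [0, 1], [], []],
   [[0, 0, 0, -1], [], [], [], [], [1], [], [0, 1], [0, 0, 1], []],
   [[], [], [0, 0, 1], [], [], [], [1], [], [], []],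
   [[1], [], [], [], [], [1], [], [], [], []],
   [[], [], [0, 0, 0, 1], [], [], [0, 1], [], [], [], []],
   [[], [1], [], [0, 0, 1], [], [], [], [], [], []],
   [[], [], [], [], [], [], [1], [], [], []],
   [[], [0, 0, 1], [], [], [], [], [0, 1], [], [], []],
   [[], [], [], [], [], [], [], [], [0, 1], []],
   [[], [], [], [], [], [], [], [], [], [0, 1]],
   [[0, 0, 0, 1], [], [], [], [0, 1], [], [], [], [], [0, -1]],
   [[], [], [], [0, 0, 0, 1], [0, -1], [], [], [], [], []],
   [[], [0, 0, 1], [], [], [], [], [], [], [], [0, 1]],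
   [[], [], [], [], [0, -1], [], [], [], [], [0, 1]],
   [[], [], [0, 0, 0, 1], [], [], [], [], [], [], [0, -1]],
   [[], [], [], [], [], [], [0, 0, 1], [], [], [0, 1]],
   [[], [], [], [], [0, -1], [], [], [], [0, 0, 0, 1], []],
   [[], [], [], [], [0, 1], [], [], [], [], []],
   [[0, 0, 0, 1], [0, 0, 1], [], [], [0, 1], [], [], [], [], []],
   [[], [], [], [], [], [], [], [0, 0, 0, 1], [], [0, -1]],
   [[], [], [], [], [0, 1], [0, 0, 0, 1], [], [], [], [0, -1]],
   [[], [], [], [], [0, 1], [0, 0, 0, 1], [0, 0, 1], [], [], []]]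

/-- `Vₜ ∈ ℤ[ε]^{2×5}`: the vectors on the left-factor slot `A` (flat position `j + 5·i` of `(i,j)`). [cite: BensonBallard2015, file codegen/algorithms/smirnov255-37-262-approx (Smirnov's approximate ⟨5,5,2; 37⟩)] [cite: Smirnov2013, approximate algorithms for ⟨5,5,2⟩, as quoted in ConnerHarperLandsberg2023 §1 p. 4] -/
def cV : List (List (List ℤ)) :=
  [[[], [], [1], [], [], [], [0, -1], [], [0, 0, -1], []],
   [[], [1], [1], [0, 1], [], [], [0, -1], [], [0, 0, -1], []],
   [[1], [], [], [], [], [0, 0, 1], [], [0, 1], [], []],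
   [[0, -1], [], [1], [], [], [0, 0, 1], [], [], [0, 0, 1], []],
   [[], [], [], [], [], [0, -1], [1], [], [], []],
   [[-1], [], [], [], [], [], [0, 0, 1], [], [0, 0, 0, 1], []],
   [[], [], [1], [], [], [0, 0, 1], [], [], [0, 0, 1], []],
   [[], [1], [], [], [], [0, 0, 1], [0, -1], [], [], []],
   [[], [-1], [], [], [], [], [0, 1], [1], [0, 0, 1], []],
   [[-1], [], [], [], [], [0, 0, 0, 1], [], [], [], []],
   [[], [], [], [], [], [], [1], [], [], []],
   [[], [], [], [], [], [], [0, 1], [1], [0, 0, 1], []],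
   [[], [], [1], [], [], [], [], [], [0, 0, 1], []],
   [[], [], [1], [0, 0, 1], [], [], [], [], [], []],
   [[], [1], [], [0, 1], [], [], [], [], [], []],
   [[], [], [], [], [], [], [], [1], [], []],
   [[], [], [], [], [], [0, 0, 1], [], [1], [], []],
   [[], [1], [], [], [], [], [1], [], [], []],
   [[], [], [-1], [], [], [], [], [], [], []],
   [[], [], [1], [], [], [], [], [0, -1], [0, 0, 1], []],
   [[0, 0, 1], [1], [], [0, 1], [], [], [], [], [], []],
   [[], [1], [], [], [], [], [], [], [], []],
   [[], [-1], [], [], [], [], [], [], [0, 0, 1], []],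
   [[1], [], [], [], [], [0, 0, 1], [], [], [], []],
   [[], [], [], [], [1], [], [0, 0, -1], [], [], [1]],
   [[], [], [], [], [1], [], [], [], [], []],
   [[], [], [0, 1], [], [1], [], [], [], [], []],
   [[], [], [], [], [1], [0, 0, 1], [], [], [], []],
   [[], [], [], [], [1], [], [], [], [], [1]],
   [[], [], [], [], [1], [], [], [0, -1], [], []],
   [[], [], [], [], [], [], [], [], [0, 0, 1], [-1]],
   [[], [0, 0, 1], [0, -1], [], [], [], [], [], [], [1]],
   [[], [0, 0, 1], [], [], [1], [], [], [], [], [1]],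
   [[0, 0, 1], [], [], [], [-1], [], [], [], [], []],
   [[], [], [], [], [], [], [0, 0, -1], [0, 1], [], [1]],
   [[], [], [], [], [], [], [], [], [], [1]],
   [[], [], [], [0, 0, 1], [], [], [], [], [], [1]]]

/-- `Wₜ ∈ ℤ[ε]^{5×5}`: the vectors on the right-factor slot `B` (flat position `l + 5·j` of `(j,l)`). [cite: BensonBallard2015, file codegen/algorithms/smirnov255-37-262-approx (Smirnov's approximate ⟨5,5,2; 37⟩)] [cite: Smirnov2013, approximate algorithms for ⟨5,5,2⟩, as quoted in ConnerHarperLandsberg2023 §1 p. 4] -/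
def cW : List (List (List ℤ)) :=
  [[[], [], [], [], [], [0, 0, -1], [], [], [], [], [], [0, 0, 0, 1], [], [], [], [], [], [1], [], [], [], [], [], [], []],
   [[], [], [], [], [], [0, 0, 1], [], [], [], [], [], [], [], [], [], [], [], [-1], [], [], [], [], [], [], []],
   [[], [], [-1], [], [], [], [], [], [], [], [], [], [], [0, 1], [], [], [], [], [], [], [], [], [], [], []],
   [[0, 1], [], [-1], [], [], [], [], [], [], [], [], [], [], [0, 1], [], [], [], [], [], [], [], [], [], [], []],
   [[], [0, 1], [], [], [], [], [], [], [0, 1], [], [], [], [], [], [], [], [], [], [-1], [], [], [], [], [], []],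
   [[], [0, -1], [], [], [], [], [], [], [], [], [], [], [], [], [], [], [], [], [1], [], [], [], [], [], []],
   [[0, 1], [], [-1], [], [], [], [], [], [], [], [], [], [], [], [], [], [], [], [], [], [], [], [], [], []],
   [[], [], [], [], [], [], [], [], [0, -1], [], [], [0, 0, 0, 1], [], [], [], [], [], [], [1], [], [], [], [], [], []],
   [[], [], [], [], [], [], [], [], [], [], [], [0, 0, 0, 1], [], [], [], [], [], [-1], [], [], [], [], [], [], []],
   [[], [0, 1], [], [0, 1], [], [], [], [], [], [], [], [], [], [0, 0, 1], [], [], [], [], [-1], [], [], [], [], [], []],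
   [[], [0, 0, 1], [], [], [], [], [0, 0, 0, 1], [0, -1], [], [], [], [], [], [], [], [], [], [1], [], [], [], [], [], [], []],
   [[], [], [], [], [], [], [], [], [], [], [], [], [], [], [], [], [], [1], [], [], [], [], [], [], []],
   [[0, 1], [], [-1], [], [], [], [], [], [], [], [], [0, 0, 0, 1], [0, 1], [], [], [0, -1], [], [], [], [], [], [], [], [], []],
   [[], [], [], [], [], [0, 0, -1], [], [], [], [], [0, 0, 0, 1], [], [], [0, 0, 1], [], [0, 1], [], [1], [], [], [], [], [], [], []],
   [[], [], [], [], [], [0, 0, -1], [0, 0, 0, 1], [], [], [], [], [], [], [], [], [], [0, 0, 1], [1], [-1], [], [], [], [], [], []],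
   [[], [], [-1], [], [], [], [], [], [], [], [0, 0, 0, 1], [], [0, 0, 1], [], [], [], [], [-1], [], [], [], [], [], [], []],
   [[], [], [1], [], [], [], [], [], [], [], [], [], [], [], [], [], [], [], [], [], [], [], [], [], []],
   [[], [], [], [], [], [], [], [0, 1], [], [], [], [], [], [], [], [], [], [-1], [], [], [], [], [], [], []],
   [[], [], [], [], [], [0, 0, -1], [], [], [], [], [], [], [], [], [], [0, 1], [], [1], [], [], [], [], [], [], []],
   [[], [], [], [], [], [], [], [], [], [], [], [], [1], [], [], [], [], [], [], [], [], [], [], [], []],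
   [[], [], [], [], [], [], [], [], [], [], [], [], [], [], [], [], [], [], [1], [], [], [], [], [], []],
   [[], [], [], [], [], [], [], [0, -1], [0, 1], [], [], [], [], [], [], [], [0, 1], [], [-1], [], [], [], [], [], []],
   [[], [], [], [], [], [], [], [], [], [], [], [], [], [], [], [], [1], [], [], [], [], [], [], [], []],
   [[], [], [1], [1], [], [], [], [], [], [], [], [], [], [], [], [], [], [], [], [], [], [], [], [], []],
   [[], [], [], [], [], [], [], [], [], [-1], [], [], [], [], [], [], [], [], [], [], [], [0, -1], [1], [], [0, 0, 1]],
   [[], [], [], [], [1], [], [], [], [], [], [], [], [], [], [0, -1], [], [], [], [], [], [1], [], [], [], [0, 0, 1]],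
   [[], [], [], [], [], [], [], [], [], [], [], [], [], [], [0, -1], [], [], [], [], [], [], [], [], [1], []],
   [[], [], [], [], [1], [], [], [], [], [], [], [], [], [], [], [], [], [], [], [], [], [0, 1], [], [], []],
   [[], [], [], [], [], [], [], [], [], [1], [], [], [], [], [], [], [], [], [], [], [1], [], [], [], []],
   [[], [], [], [], [], [], [], [], [], [], [], [], [], [], [0, 1], [], [], [], [], [], [], [], [1], [], []],
   [[], [], [], [], [], [], [], [], [], [], [], [], [], [], [], [], [], [], [], [1], [], [0, -1], [], [], []],
   [[], [], [], [], [], [], [], [], [], [], [], [], [], [], [], [], [], [], [], [], [], [], [], [1], []],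
   [[], [], [], [], [], [], [], [], [], [1], [], [], [], [], [], [], [], [], [], [], [], [], [], [1], []],
   [[], [], [], [], [1], [], [], [], [], [], [], [], [], [], [], [], [], [], [], [], [], [], [], [], []],
   [[], [], [], [], [], [], [], [], [], [], [], [], [], [], [], [], [], [], [], [], [], [], [1], [], []],
   [[], [], [], [], [], [], [], [], [], [], [], [], [], [], [], [], [], [], [], [-1], [1], [], [], [], []],
   [[], [], [], [], [], [], [], [], [], [], [], [], [], [], [], [], [], [], [], [1], [], [], [], [], []]]

/-! ## The finite check, one kernel evaluation per `C`-coordinate (`ApproxCert.checkRow`) -/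

/-- Row `0` of the certificate check (entries `(0, j, l)`, degrees `0, …, 3`). [cite: BensonBallard2015, file codegen/algorithms/smirnov255-37-262-approx (Smirnov's approximate ⟨5,5,2; 37⟩)] -/
theorem row_0 : ApproxCert.checkRow 10 10 25 37 3 1 (matMulFlat 2 5 5) (ptab cU) (ptab cV) (ptab cW) ⟨0, by decide⟩ = true := by
  decide +kernel

/-- Row `1` of the certificate check (entries `(1, j, l)`, degrees `0, …, 3`). [cite: BensonBallard2015, file codegen/algorithms/smirnov255-37-262-approx (Smirnov's approximate ⟨5,5,2; 37⟩)] -/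
theorem row_1 : ApproxCert.checkRow 10 10 25 37 3 1 (matMulFlat 2 5 5) (ptab cU) (ptab cV) (ptab cW) ⟨1, by decide⟩ = true := by
  decide +kernel

/-- Row `2` of the certificate check (entries `(2, j, l)`, degrees `0, …, 3`). [cite: BensonBallard2015, file codegen/algorithms/smirnov255-37-262-approx (Smirnov's approximate ⟨5,5,2; 37⟩)] -/
theorem row_2 : ApproxCert.checkRow 10 10 25 37 3 1 (matMulFlat 2 5 5) (ptab cU) (ptab cV) (ptab cW) ⟨2, by decide⟩ = true := by
  decide +kernel

/-- Row `3` of the certificate check (entries `(3, j, l)`, degrees `0, …, 3`). [cite: BensonBallard2015, file codegen/algorithms/smirnov255-37-262-approx (Smirnov's approximate ⟨5,5,2; 37⟩)] -/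
theorem row_3 : ApproxCert.checkRow 10 10 25 37 3 1 (matMulFlat 2 5 5) (ptab cU) (ptab cV) (ptab cW) ⟨3, by decide⟩ = true := by
  decide +kernel

/-- Row `4` of the certificate check (entries `(4, j, l)`, degrees `0, …, 3`). [cite: BensonBallard2015, file codegen/algorithms/smirnov255-37-262-approx (Smirnov's approximate ⟨5,5,2; 37⟩)] -/
theorem row_4 : ApproxCert.checkRow 10 10 25 37 3 1 (matMulFlat 2 5 5) (ptab cU) (ptab cV) (ptab cW) ⟨4, by decide⟩ = true := by
  decide +kernel

/-- Row `5` of the certificate check (entries `(5, j, l)`, degrees `0, …, 3`). [cite: BensonBallard2015, file codegen/algorithms/smirnov255-37-262-approx (Smirnov's approximate ⟨5,5,2; 37⟩)] -/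
theorem row_5 : ApproxCert.checkRow 10 10 25 37 3 1 (matMulFlat 2 5 5) (ptab cU) (ptab cV) (ptab cW) ⟨5, by decide⟩ = true := by
  decide +kernel

/-- Row `6` of the certificate check (entries `(6, j, l)`, degrees `0, …, 3`). [cite: BensonBallard2015, file codegen/algorithms/smirnov255-37-262-approx (Smirnov's approximate ⟨5,5,2; 37⟩)] -/
theorem row_6 : ApproxCert.checkRow 10 10 25 37 3 1 (matMulFlat 2 5 5) (ptab cU) (ptab cV) (ptab cW) ⟨6, by decide⟩ = true := by
  decide +kernel

/-- Row `7` of the certificate check (entries `(7, j, l)`, degrees `0, …, 3`). [cite: BensonBallard2015, file codegen/algorithms/smirnov255-37-262-approx (Smirnov's approximate ⟨5,5,2; 37⟩)] -/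
theorem row_7 : ApproxCert.checkRow 10 10 25 37 3 1 (matMulFlat 2 5 5) (ptab cU) (ptab cV) (ptab cW) ⟨7, by decide⟩ = true := by
  decide +kernel

/-- Row `8` of the certificate check (entries `(8, j, l)`, degrees `0, …, 3`). [cite: BensonBallard2015, file codegen/algorithms/smirnov255-37-262-approx (Smirnov's approximate ⟨5,5,2; 37⟩)] -/
theorem row_8 : ApproxCert.checkRow 10 10 25 37 3 1 (matMulFlat 2 5 5) (ptab cU) (ptab cV) (ptab cW) ⟨8, by decide⟩ = true := by
  decide +kernel

/-- Row `9` of the certificate check (entries `(9, j, l)`, degrees `0, …, 3`). [cite: BensonBallard2015, file codegen/algorithms/smirnov255-37-262-approx (Smirnov's approximate ⟨5,5,2; 37⟩)] -/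
theorem row_9 : ApproxCert.checkRow 10 10 25 37 3 1 (matMulFlat 2 5 5) (ptab cU) (ptab cV) (ptab cW) ⟨9, by decide⟩ = true := by
  decide +kernel

/-- **The whole certificate checks**: `∑ₜ Uₜ ⊗ Vₜ ⊗ Wₜ = ε^3 · ⟨2,5,5⟩ + O(ε^4)` (flat format). [cite: BensonBallard2015, file codegen/algorithms/smirnov255-37-262-approx (Smirnov's approximate ⟨5,5,2; 37⟩)] -/
theorem check : ApproxCert.check 10 10 25 37 3 1 (matMulFlat 2 5 5) (ptab cU) (ptab cV) (ptab cW) = true :=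
  ApproxCert.check_of_forall_checkRow fun i => by
    fin_cases i
    exacts [row_0, row_1, row_2, row_3, row_4, row_5, row_6, row_7, row_8, row_9]

end Smirnov2013.M255


/-! ## The bounds -/

section Bounds

variable (K : Type*) [CommRing K]

/-- **`R₃(⟨2,5,5⟩) ≤ 37`** over every commutative ring (order-`3` approximate rank): Smirnov's
approximate algorithm `⟨5,5,2; 37⟩`, rotated. [cite: BensonBallard2015, file
codegen/algorithms/smirnov255-37-262-approx (Smirnov's approximate ⟨5,5,2; 37⟩)] -/
theorem Smirnov2013_approxRank_three_matMulTensor_255_le :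
    approxRank 3 (matMulTensor K 2 5 5) ≤ 37 :=
  approxRank_matMulTensor_le_of_check K Smirnov2013.M255.check (by simp)

/-- **`bR(⟨2,5,5⟩) ≤ 37`** (a `2 × 5` by a `5 × 5` matrix), over every commutative ring; over `ℂ` it
implies the named fact `Smirnov2013_borderRank_matMulTensor_255_le` (`≤ 38`, the value quoted by CHL
2023 p. 4). [cite: BensonBallard2015, file codegen/algorithms/smirnov255-37-262-approx (Smirnov's
approximate ⟨5,5,2; 37⟩)] [cite: Smirnov2013, approximate algorithms for ⟨5,5,2⟩, as quoted in
ConnerHarperLandsberg2023 §1 p. 4] -/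
theorem Smirnov2013_algBorderRank_matMulTensor_255_le_thirtySeven :
    algBorderRank (matMulTensor K 2 5 5) ≤ 37 :=
  algBorderRank_matMulTensor_le_of_check K Smirnov2013.M255.check (by simp)

/-- **`bR(⟨5,5,2⟩) ≤ 37`** (Smirnov's format `5 × 5` by `5 × 2`; cyclic rotation, Bläser Thm. 6.3(1)).
[cite: BensonBallard2015, file codegen/algorithms/smirnov255-37-262-approx (Smirnov's approximate ⟨5,5,2; 37⟩)] -/
theorem Smirnov2013_algBorderRank_matMulTensor_552_le :
    algBorderRank (matMulTensor K 5 5 2) ≤ 37 :=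
  (algBorderRank_le_approxRank 3 _).trans
    ((approxRank_matMulTensor_rotate_le K 3 2 5 5).trans
      (Smirnov2013_approxRank_three_matMulTensor_255_le K))

/-- **`bR(⟨5,2,5⟩) ≤ 37`** (the third cyclic format). [cite: BensonBallard2015, file
codegen/algorithms/smirnov255-37-262-approx (Smirnov's approximate ⟨5,5,2; 37⟩)] -/
theorem Smirnov2013_algBorderRank_matMulTensor_525_le :
    algBorderRank (matMulTensor K 5 2 5) ≤ 37 :=
  (algBorderRank_le_approxRank 3 _).trans
    ((approxRank_matMulTensor_rotate_le K 3 5 5 2).trans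
      ((approxRank_matMulTensor_rotate_le K 3 2 5 5).trans
        (Smirnov2013_approxRank_three_matMulTensor_255_le K)))

end Bounds

end Literature.Computability.AlgebraicComplexity

end
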